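import Mathlib
import Literature.Computability.AlgebraicComplexity.SimultaneousDoubleProduct
import Literature.Computability.AlgebraicComplexity.ChartUSP
import Summits.MatrixMultiplication.MatrixMultiplication.Theorems.EisensteinValCertificatesHomocyclicSTPPDesignsChartCapacity

/-!
# Designs over the rotated two-family chart need dense SDPP families (line `registered` of crux
`EisensteinValCertificates.HomocyclicSTPPDesigns`, stmt-MatrixMultiplication-10647; lead c4, `--supports`)

Companion of `…ChartCapacity.lean` (the row bound `chartCapacity_rows_cube_le` for fixed-layout local
chart-USPs over the rotated chart
`(t,0) ↦ (A_t, B_t, {0})`, `(t,1) ↦ ({0}, A_t, B_t)`, `(t,2) ↦ (B_t, {0}, A_t)` of an SDPP family,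
Cohn–Kleinberg–Szegedy–Umans 2005 §6.2).  Here the arbitrary-rows bound and the numerical consequence used by the
crux analysis `Cruxes/HomocyclicSTPPDesigns/CHART-CAPACITY.md`:

* `chartCapacity_rows_cube_le_mixed` — for ANY local chart-USP `row : Fin L → Fin k → Fin n × Fin 3`
  (roles mixed per row and coordinate): `L³ · (ab)^k ≤ 27^k · n^{2k} · |H|^k` (the fibre of a role word is a
  fixed-layout local chart-USP; there are `3^k` role words); registered closed form `chartCapacity_cube_mixed`;
* `chartCapacity_density_of_beats` — if `L³ · v^k ≤ M^k · N^k` and `L` blocks of volume `v^k` beat exponent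
  `2 + ε` (`N^k < L · (v^k)^{(2+ε)/3}`), then `N² < M · v^{1+ε}` (cube, insert, `k`-th root);
* `chartCapacity_designs_need_density` — in `ℤ/p`: if the CKSU Thm. 37 blocks of a fixed-layout local
  chart-USP over the rotated chart of an SDPP family (`|A_t| = a`, `|B_t| = b`) satisfy
  `p^k < Σ_u (|A'_u||B'_u||C'_u|)^{(2+ε)/3}`, then `p² < n² (ab)^{1+ε}` — the pair packing `n² ab ≤ p²` of
  the INPUT family is tight up to `(ab)^ε` (`σ₁ < (ab)^ε`);
* `chartCapacity_designs_need_density_mixed` — the same for arbitrary rows, with the constant `27`;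
  registered closed forms `chartCapacity_needDensity`, `chartCapacity_needDensity_mixed`.

So every design of the line's mechanism — whatever replaces its class-word × corner-free-square rows —
needs DENSE SDPP families: the density clause of the open leaf `stub_clusteredTwoFamilies` cannot be
weakened inside the line, and a power saving for SDPP families in prime cyclic groups
(`FourierTwoFamiliesModP.PrimeCyclicPowerGain`, stmt-14309) obstructs the whole mechanism (for the
clustered leaf itself this is the landed `not_clusteredTwoFamilies_of_primeCyclicPowerGain`).
Sources for the notions: CKSU 2005 (arXiv:math/0511460) §4, §6.2; Pratt 2024 (ITCS) §4; nothing is cited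
as a fact.
-/

set_option linter.dupNamespace false
-- (single-conjunct summit: the namespace repeats `MatrixMultiplication`)

namespace Summit.MatrixMultiplication.MatrixMultiplication.Theorems.HomocyclicSTPPDesigns.ClusteredCharts

open Literature.Computability.AlgebraicComplexity Finset
open scoped Pointwise

section Mixed

variable {H : Type*} [AddCommGroup H] [DecidableEq H] {n : ℕ} {A B : Fin n → Finset H}
  {cA cB cC : Fin n × Fin 3 → Finset H}

/-- **Capacity of the rotated two-family chart, arbitrary rows** (Theorem B of `CHART-CAPACITY.md`): for
ANY local chart-USP `row : Fin L → Fin k → Fin n × Fin 3` over the rotated chart (roles mixed freely per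
row and coordinate), `L³ · (ab)^k ≤ 27^k · n^{2k} · |H|^k`.  Proof: the fibre of a role word
`ρ : Fin k → Fin 3` is a fixed-layout local chart-USP, so `chartCapacity_rows_cube_le` bounds it; there are
`3^k` role words, and `L ≤ 3^k · (largest fibre)`. [folklore] -/
theorem chartCapacity_rows_cube_le_mixed [Fintype H] {a b : ℕ} (hS : IsSDPP A B) (ha : 1 ≤ a)
    (hb : 1 ≤ b) (hcard : ∀ i, (A i).card = a ∧ (B i).card = b)
    (hA0 : ∀ i, cA (i, 0) = A i) (hA1 : ∀ i, cA (i, 1) = {0}) (hA2 : ∀ i, cA (i, 2) = B i)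
    (hB0 : ∀ i, cB (i, 0) = B i) (hB1 : ∀ i, cB (i, 1) = A i) (hB2 : ∀ i, cB (i, 2) = {0})
    (hC0 : ∀ i, cC (i, 0) = {0}) (hC1 : ∀ i, cC (i, 1) = B i) (hC2 : ∀ i, cC (i, 2) = A i)
    {k L : ℕ} (row : Fin L → Fin k → Fin n × Fin 3) (hU : IsLocalChartUSP cA cB cC row) :
    L ^ 3 * (a * b) ^ k ≤ 27 ^ k * (n ^ (2 * k) * Fintype.card H ^ k) := by
  classical
  -- the role word of a row, and the fibres
  set wd : Fin L → (Fin k → Fin 3) := fun u c => (row u c).2 with hwd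
  set fib : (Fin k → Fin 3) → Finset (Fin L) := fun ρ => univ.filter fun u => wd u = ρ with hfib
  -- (1) each fibre is a fixed-layout local chart-USP, so the cube bound applies to it
  have hfibre : ∀ ρ, (fib ρ).card ^ 3 * (a * b) ^ k ≤ n ^ (2 * k) * Fintype.card H ^ k := by
    intro ρ
    set e := (fib ρ).equivFin.symm with he
    have hrow : ∀ (i : Fin (fib ρ).card) (c : Fin k), row (e i).1 c = ((row (e i).1 c).1, ρ c) := by
      intro i c
      have h : (e i).1 ∈ fib ρ := (e i).2
      simp only [hfib, Finset.mem_filter, Finset.mem_univ, true_and] at h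
      have h2 : (row (e i).1 c).2 = ρ c := congrFun h c
      exact Prod.ext rfl h2
    have hU' : IsLocalChartUSP cA cB cC (fun i c => ((row (e i).1 c).1, ρ c)) := by
      intro i j l hne
      have hne' : ¬ ((e i).1 = (e j).1 ∧ (e j).1 = (e l).1) := by
        rintro ⟨h1, h2⟩
        exact hne ⟨e.injective (Subtype.ext h1), e.injective (Subtype.ext h2)⟩
      obtain ⟨c, hc⟩ := hU (e i).1 (e j).1 (e l).1 hne'
      refine ⟨c, ?_⟩
      show (((row (e i).1 c).1, ρ c), ((row (e j).1 c).1, ρ c), ((row (e l).1 c).1, ρ c)) ∈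
        chartHypergraph cA cB cC
      rw [← hrow i c, ← hrow j c, ← hrow l c]
      exact hc
    exact chartCapacity_rows_cube_le hS ha hb hcard hA0 hA1 hA2 hB0 hB1 hB2 hC0 hC1 hC2 ρ
      (fun i c => (row (e i).1 c).1) hU'
  -- (2) `L = Σ_ρ |fib ρ| ≤ 3^k · max_ρ |fib ρ|`
  have hLsum : L = ∑ ρ : Fin k → Fin 3, (fib ρ).card := by
    have h := Finset.card_eq_sum_card_fiberwise (f := wd) (s := (univ : Finset (Fin L)))
      (t := (univ : Finset (Fin k → Fin 3))) (fun x _ => Finset.mem_coe.2 (Finset.mem_univ _))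
    rw [Finset.card_univ, Fintype.card_fin] at h
    exact h
  obtain ⟨ρ₀, -, hmax⟩ := Finset.exists_max_image (univ : Finset (Fin k → Fin 3))
    (fun ρ => (fib ρ).card) Finset.univ_nonempty
  have hL : L ≤ 3 ^ k * (fib ρ₀).card := by
    have h := Finset.sum_le_card_nsmul (univ : Finset (Fin k → Fin 3)) (fun ρ => (fib ρ).card)
      ((fib ρ₀).card) (fun ρ hρ => hmax ρ hρ)
    rw [Finset.card_univ, Fintype.card_fun, Fintype.card_fin, Fintype.card_fin, smul_eq_mul] at h
    calc L = ∑ ρ : Fin k → Fin 3, (fib ρ).card := hLsum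
      _ ≤ 3 ^ k * (fib ρ₀).card := h
  have h27 : (3 ^ k) ^ 3 = (27 : ℕ) ^ k := by
    rw [← pow_mul, mul_comm, pow_mul]
    norm_num
  calc L ^ 3 * (a * b) ^ k ≤ (3 ^ k * (fib ρ₀).card) ^ 3 * (a * b) ^ k := by gcongr
    _ = 27 ^ k * ((fib ρ₀).card ^ 3 * (a * b) ^ k) := by rw [mul_pow, h27]; ring
    _ ≤ 27 ^ k * (n ^ (2 * k) * Fintype.card H ^ k) := Nat.mul_le_mul_left _ (hfibre ρ₀)

end Mixed

section Density

/-- `(x ^ y) ^ n = (x ^ n) ^ y` for `x ≥ 0` (real `rpow` versus the monoid power). [folklore] -/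
private theorem chartCapacity_rpow_pow_comm {x : ℝ} (hx : 0 ≤ x) (y : ℝ) (n : ℕ) :
    (x ^ y) ^ n = (x ^ n) ^ y := by
  rw [← Real.rpow_natCast (x ^ y) n, ← Real.rpow_mul hx, mul_comm, Real.rpow_mul hx,
    Real.rpow_natCast]

/-- **Designs over the rotated chart need dense SDPP families** (Corollary C of `CHART-CAPACITY.md`), the
numerical step: if `L³ · v^k ≤ M^k · N^k` (a capacity bound: `v = ab`, `N = |H|`, `M = n²` for a fixed
layout, `M = 27 n²` for arbitrary rows) and the `L` blocks of volume `v^k` BEAT exponent `2 + ε` —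
`N^k < L · (v^k)^{(2+ε)/3}` — then `N² < M · v^{1+ε}`; for `M = n²` this says that the pair-packing slack
`σ₁ = N²/(n² v)` is `< v^ε`.  (Cube the merit, insert the capacity bound, take `k`-th roots.) [folklore] -/
theorem chartCapacity_density_of_beats {N M v k L : ℕ} (hv : 1 ≤ v) (hN : 1 ≤ N)
    (hcube : L ^ 3 * v ^ k ≤ M ^ k * N ^ k) {ε : ℝ}
    (hbeat : (N : ℝ) ^ k < (L : ℝ) * ((v ^ k : ℕ) : ℝ) ^ ((2 + ε) / 3)) :
    (N : ℝ) ^ 2 < (M : ℝ) * (v : ℝ) ^ (1 + ε) := by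
  -- signs
  have hV : (1 : ℝ) ≤ v := by exact_mod_cast hv
  have hV0 : (0 : ℝ) < v := by linarith
  have hVk0 : (0 : ℝ) < (v : ℝ) ^ k := pow_pos hV0 k
  have hNr : (1 : ℝ) ≤ N := by exact_mod_cast hN
  have hN0 : (0 : ℝ) < N := by linarith
  have hM0 : (0 : ℝ) ≤ M := Nat.cast_nonneg M
  rw [Nat.cast_pow] at hbeat
  set W : ℝ := ((v : ℝ) ^ k) ^ ε with hW
  have hW0 : 0 < W := Real.rpow_pos_of_pos hVk0 ε
  -- (1) cube the merit: `N^{3k} < L³ · v^{2k} · W`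
  have hE3 : (((v : ℝ) ^ k) ^ ((2 + ε) / 3)) ^ 3 = ((v : ℝ) ^ k) ^ 2 * W := by
    rw [← Real.rpow_natCast (((v : ℝ) ^ k) ^ ((2 + ε) / 3)) 3, ← Real.rpow_mul hVk0.le]
    have e : (2 + ε) / 3 * ((3 : ℕ) : ℝ) = 2 + ε := by push_cast; ring
    rw [e, Real.rpow_add hVk0, Real.rpow_two]
  have h1 : ((N : ℝ) ^ k) ^ 3 < (L : ℝ) ^ 3 * (((v : ℝ) ^ k) ^ 2 * W) := by
    have := pow_lt_pow_left₀ hbeat (pow_nonneg hN0.le k) three_ne_zero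
    rwa [mul_pow, hE3] at this
  -- (2) the capacity bound in `ℝ`
  have h2 : (L : ℝ) ^ 3 * (v : ℝ) ^ k ≤ (M : ℝ) ^ k * (N : ℝ) ^ k := by
    exact_mod_cast hcube
  -- (3) combine: `N^{3k} < M^k · N^k · v^k · W`
  have h3 : ((N : ℝ) ^ k) ^ 3 < (M : ℝ) ^ k * (N : ℝ) ^ k * ((v : ℝ) ^ k * W) := by
    calc ((N : ℝ) ^ k) ^ 3 < (L : ℝ) ^ 3 * (((v : ℝ) ^ k) ^ 2 * W) := h1
      _ = ((L : ℝ) ^ 3 * (v : ℝ) ^ k) * ((v : ℝ) ^ k * W) := by ring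
      _ ≤ ((M : ℝ) ^ k * (N : ℝ) ^ k) * ((v : ℝ) ^ k * W) := by gcongr
  -- (4) if `M v^{1+ε} ≤ N²` then `M^k · v^k · W ≤ N^{2k}`, contradicting (3)
  by_contra hle
  rw [not_lt] at hle
  have hpow : ((M : ℝ) * (v : ℝ) ^ (1 + ε)) ^ k ≤ ((N : ℝ) ^ 2) ^ k :=
    pow_le_pow_left₀ (by positivity) hle k
  have hexp : ((M : ℝ) * (v : ℝ) ^ (1 + ε)) ^ k = (M : ℝ) ^ k * ((v : ℝ) ^ k * W) := by
    rw [mul_pow, Real.rpow_add hV0, Real.rpow_one, mul_pow, hW,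
      chartCapacity_rpow_pow_comm hV0.le ε k]
  rw [hexp, ← pow_mul] at hpow
  have h4 : (M : ℝ) ^ k * (N : ℝ) ^ k * ((v : ℝ) ^ k * W) ≤ ((N : ℝ) ^ k) ^ 3 := by
    calc (M : ℝ) ^ k * (N : ℝ) ^ k * ((v : ℝ) ^ k * W)
        = ((M : ℝ) ^ k * ((v : ℝ) ^ k * W)) * (N : ℝ) ^ k := by ring
      _ ≤ (N : ℝ) ^ (2 * k) * (N : ℝ) ^ k := by gcongr
      _ = ((N : ℝ) ^ k) ^ 3 := by ring
  exact absurd (h3.trans_le h4) (lt_irrefl _)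

end Density

section Designs

/-- The three elements of `Fin 3`. [folklore] -/
private theorem chartCapacityD_fin3 : ∀ r : Fin 3, r = 0 ∨ r = 1 ∨ r = 2 := by decide

variable {H : Type*} [AddCommGroup H] [DecidableEq H] {n : ℕ} {A B : Fin n → Finset H}
  {cA cB cC : Fin n × Fin 3 → Finset H}

omit [DecidableEq H] in
/-- Block volumes over the rotated chart: with `|A_t| = a`, `|B_t| = b` every product block of a row of
width `k` has `|A'_u| |B'_u| |C'_u| = (ab)^k` (each coordinate contributes `a · b · 1` in some order).
[cite: CohnKleinbergSzegedyUmans2005, §6.2] -/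
private theorem chartCapacity_card_block {a b : ℕ} (hcard : ∀ i, (A i).card = a ∧ (B i).card = b)
    (hA0 : ∀ i, cA (i, 0) = A i) (hA1 : ∀ i, cA (i, 1) = {0}) (hA2 : ∀ i, cA (i, 2) = B i)
    (hB0 : ∀ i, cB (i, 0) = B i) (hB1 : ∀ i, cB (i, 1) = A i) (hB2 : ∀ i, cB (i, 2) = {0})
    (hC0 : ∀ i, cC (i, 0) = {0}) (hC1 : ∀ i, cC (i, 1) = B i) (hC2 : ∀ i, cC (i, 2) = A i)
    {k L : ℕ} (row : Fin L → Fin k → Fin n × Fin 3) (u : Fin L) :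
    (chartBlock cA row u).card * (chartBlock cB row u).card * (chartBlock cC row u).card =
      (a * b) ^ k := by
  have hx : ∀ x : Fin n × Fin 3, (cA x).card * (cB x).card * (cC x).card = a * b := by
    rintro ⟨i, r⟩
    obtain ⟨hA, hB⟩ := hcard i
    rcases chartCapacityD_fin3 r with rfl | rfl | rfl
    · rw [hA0, hB0, hC0, hA, hB, Finset.card_singleton, mul_one]
    · rw [hA1, hB1, hC1, hA, hB, Finset.card_singleton, one_mul]
    · rw [hA2, hB2, hC2, hA, hB, Finset.card_singleton, mul_one, mul_comm]
  simp only [chartBlock, Fintype.card_piFinset]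
  rw [← Finset.prod_mul_distrib, ← Finset.prod_mul_distrib]
  rw [Finset.prod_congr rfl fun c _ => hx (row u c)]
  rw [Finset.prod_const, Finset.card_univ, Fintype.card_fin]

/-- **Every design of line `registered`'s mechanism needs a dense SDPP family** (Corollary C of
`Cruxes/HomocyclicSTPPDesigns/CHART-CAPACITY.md`, the form consumed by the crux analysis).  Let
`(A_t, B_t)_{t<n}` be an SDPP family in `ℤ/p` (`p` prime) with `|A_t| = a ≥ 1`, `|B_t| = b ≥ 1`, and let rows
with ANY fixed role layout form a local chart-USP over the rotated chart (so that CKSU Thm. 37 turns their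
product blocks into an STPP family in `(ℤ/p)^k`, cf. `CohnKleinbergSzegedyUmans2005_thm37`).  If these
blocks beat exponent `2 + ε` — `p^k < Σ_u (|A'_u||B'_u||C'_u|)^{(2+ε)/3}` — then `p² < n² (ab)^{1+ε}`:
the pair packing `n² ab ≤ p²` of the INPUT family is tight up to the factor `(ab)^ε`.  Hence no reshape of
the line's row design (stubs 2–5) can weaken the density clause of its open leaf
`stub_clusteredTwoFamilies`, and a power saving for SDPP families in prime cyclic groups
(`FourierTwoFamiliesModP.PrimeCyclicPowerGain`, stmt-14309) obstructs the whole mechanism. [folklore] -/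
theorem chartCapacity_designs_need_density {p : ℕ} (hp : p.Prime) {A B : Fin n → Finset (ZMod p)}
    {a b : ℕ} (hS : IsSDPP A B) (ha : 1 ≤ a) (hb : 1 ≤ b)
    (hcard : ∀ i, (A i).card = a ∧ (B i).card = b)
    {cA cB cC : Fin n × Fin 3 → Finset (ZMod p)}
    (hA0 : ∀ i, cA (i, 0) = A i) (hA1 : ∀ i, cA (i, 1) = {0}) (hA2 : ∀ i, cA (i, 2) = B i)
    (hB0 : ∀ i, cB (i, 0) = B i) (hB1 : ∀ i, cB (i, 1) = A i) (hB2 : ∀ i, cB (i, 2) = {0})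
    (hC0 : ∀ i, cC (i, 0) = {0}) (hC1 : ∀ i, cC (i, 1) = B i) (hC2 : ∀ i, cC (i, 2) = A i)
    {k L : ℕ} (role : Fin k → Fin 3) (sym : Fin L → Fin k → Fin n)
    (hU : IsLocalChartUSP cA cB cC (fun u c => (sym u c, role c))) {ε : ℝ}
    (hbeat : (p : ℝ) ^ k < ∑ u : Fin L,
      (((chartBlock cA (fun u c => (sym u c, role c)) u).card *
        (chartBlock cB (fun u c => (sym u c, role c)) u).card *
        (chartBlock cC (fun u c => (sym u c, role c)) u).card : ℕ) : ℝ) ^ ((2 + ε) / 3)) :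
    (p : ℝ) ^ 2 < (n : ℝ) ^ 2 * ((a * b : ℕ) : ℝ) ^ (1 + ε) := by
  haveI : Fact p.Prime := ⟨hp⟩
  -- the capacity bound, with `|ℤ/p| = p`
  have hcube := chartCapacity_rows_cube_le hS ha hb hcard hA0 hA1 hA2 hB0 hB1 hB2 hC0 hC1 hC2
    role sym hU
  rw [ZMod.card] at hcube
  -- the merit: every block has volume `(ab)^k`
  have hvol : ∀ u : Fin L, ((chartBlock cA (fun u c => (sym u c, role c)) u).card *
      (chartBlock cB (fun u c => (sym u c, role c)) u).card *
      (chartBlock cC (fun u c => (sym u c, role c)) u).card : ℕ) = (a * b) ^ k := fun u =>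
    chartCapacity_card_block hcard hA0 hA1 hA2 hB0 hB1 hB2 hC0 hC1 hC2 _ u
  simp_rw [hvol] at hbeat
  rw [Finset.sum_const, Finset.card_univ, Fintype.card_fin, nsmul_eq_mul] at hbeat
  rw [pow_mul] at hcube
  have h := chartCapacity_density_of_beats (Nat.one_le_iff_ne_zero.2 (Nat.mul_ne_zero (by omega)
    (by omega))) hp.one_lt.le hcube hbeat
  rwa [Nat.cast_pow] at h


/-- **Every design over the rotated chart needs a dense SDPP family — arbitrary rows** (Corollary C with
Theorem B): as `chartCapacity_designs_need_density`, for ANY local chart-USP `row : Fin L → Fin k → Fin n × Fin 3`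
(roles mixed freely), with the constant `27` of `chartCapacity_rows_cube_le_mixed`:
blocks beating `2 + ε` force `p² < 27 · n² · (ab)^{1+ε}`. [folklore] -/
theorem chartCapacity_designs_need_density_mixed {p : ℕ} (hp : p.Prime)
    {A B : Fin n → Finset (ZMod p)} {a b : ℕ} (hS : IsSDPP A B) (ha : 1 ≤ a) (hb : 1 ≤ b)
    (hcard : ∀ i, (A i).card = a ∧ (B i).card = b)
    {cA cB cC : Fin n × Fin 3 → Finset (ZMod p)}
    (hA0 : ∀ i, cA (i, 0) = A i) (hA1 : ∀ i, cA (i, 1) = {0}) (hA2 : ∀ i, cA (i, 2) = B i)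
    (hB0 : ∀ i, cB (i, 0) = B i) (hB1 : ∀ i, cB (i, 1) = A i) (hB2 : ∀ i, cB (i, 2) = {0})
    (hC0 : ∀ i, cC (i, 0) = {0}) (hC1 : ∀ i, cC (i, 1) = B i) (hC2 : ∀ i, cC (i, 2) = A i)
    {k L : ℕ} (row : Fin L → Fin k → Fin n × Fin 3) (hU : IsLocalChartUSP cA cB cC row) {ε : ℝ}
    (hbeat : (p : ℝ) ^ k < ∑ u : Fin L,
      (((chartBlock cA row u).card * (chartBlock cB row u).card * (chartBlock cC row u).card : ℕ) :
        ℝ) ^ ((2 + ε) / 3)) :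
    (p : ℝ) ^ 2 < 27 * (n : ℝ) ^ 2 * ((a * b : ℕ) : ℝ) ^ (1 + ε) := by
  haveI : Fact p.Prime := ⟨hp⟩
  have hcube := chartCapacity_rows_cube_le_mixed hS ha hb hcard hA0 hA1 hA2 hB0 hB1 hB2 hC0 hC1
    hC2 row hU
  rw [ZMod.card, pow_mul, ← mul_assoc, ← mul_pow] at hcube
  have hvol : ∀ u : Fin L, ((chartBlock cA row u).card * (chartBlock cB row u).card *
      (chartBlock cC row u).card : ℕ) = (a * b) ^ k := fun u =>
    chartCapacity_card_block hcard hA0 hA1 hA2 hB0 hB1 hB2 hC0 hC1 hC2 _ u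
  simp_rw [hvol] at hbeat
  rw [Finset.sum_const, Finset.card_univ, Fintype.card_fin, nsmul_eq_mul] at hbeat
  have h := chartCapacity_density_of_beats (Nat.one_le_iff_ne_zero.2 (Nat.mul_ne_zero (by omega)
    (by omega))) hp.one_lt.le hcube hbeat
  have e : (((27 * n ^ 2 : ℕ)) : ℝ) = 27 * (n : ℝ) ^ 2 := by push_cast; ring
  rwa [e] at h

end Designs


section Registered

open Literature.Computability.AlgebraicComplexity

/-- **Registered form (crux stmt-MatrixMultiplication-10647, stub `chartCapacity_cube_mixed`)** of
`chartCapacity_rows_cube_le_mixed` in prime cyclic groups: every local chart-USP (arbitrary rows) over the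
rotated two-family chart of an SDPP family in `ℤ/p` with `|A_t| = a ≥ 1`, `|B_t| = b ≥ 1` has
`L³ · (ab)^k ≤ 27^k · n^{2k} · p^k`. [folklore] -/
theorem chartCapacity_cube_mixed :
    ∀ (p n a b k L : ℕ) (A B : Fin n → Finset (ZMod p)) (cA cB cC : Fin n × Fin 3 → Finset (ZMod p))
      (row : Fin L → Fin k → Fin n × Fin 3), p.Prime → IsSDPP A B → 1 ≤ a → 1 ≤ b →
      (∀ i, (A i).card = a ∧ (B i).card = b) →
      (∀ i, cA (i, 0) = A i) → (∀ i, cA (i, 1) = {0}) → (∀ i, cA (i, 2) = B i) →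
      (∀ i, cB (i, 0) = B i) → (∀ i, cB (i, 1) = A i) → (∀ i, cB (i, 2) = {0}) →
      (∀ i, cC (i, 0) = {0}) → (∀ i, cC (i, 1) = B i) → (∀ i, cC (i, 2) = A i) →
      IsLocalChartUSP cA cB cC row →
      L ^ 3 * (a * b) ^ k ≤ 27 ^ k * (n ^ (2 * k) * p ^ k) := by
  intro p n a b k L A B cA cB cC row hp hS ha hb hcard hA0 hA1 hA2 hB0 hB1 hB2 hC0 hC1 hC2 hU
  haveI : Fact p.Prime := ⟨hp⟩
  have h := chartCapacity_rows_cube_le_mixed hS ha hb hcard hA0 hA1 hA2 hB0 hB1 hB2 hC0 hC1 hC2 row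
    hU
  rwa [ZMod.card] at h

/-- **Registered form (crux stmt-MatrixMultiplication-10647, stub `chartCapacity_needDensity`)** of
`chartCapacity_designs_need_density`: if the CKSU Thm. 37 blocks of a fixed-layout local chart-USP over
the rotated two-family chart of an SDPP family in `ℤ/p` (`|A_t| = a ≥ 1`, `|B_t| = b ≥ 1`) beat exponent
`2 + ε`, then `p² < n² (ab)^{1+ε}`. [folklore] -/
theorem chartCapacity_needDensity :
    ∀ (p n a b k L : ℕ) (A B : Fin n → Finset (ZMod p)) (cA cB cC : Fin n × Fin 3 → Finset (ZMod p))
      (role : Fin k → Fin 3) (sym : Fin L → Fin k → Fin n) (ε : ℝ), p.Prime → IsSDPP A B → 1 ≤ a →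
      1 ≤ b → (∀ i, (A i).card = a ∧ (B i).card = b) →
      (∀ i, cA (i, 0) = A i) → (∀ i, cA (i, 1) = {0}) → (∀ i, cA (i, 2) = B i) →
      (∀ i, cB (i, 0) = B i) → (∀ i, cB (i, 1) = A i) → (∀ i, cB (i, 2) = {0}) →
      (∀ i, cC (i, 0) = {0}) → (∀ i, cC (i, 1) = B i) → (∀ i, cC (i, 2) = A i) →
      IsLocalChartUSP cA cB cC (fun u c => (sym u c, role c)) →
      (p : ℝ) ^ k < ∑ u : Fin L, (((chartBlock cA (fun u c => (sym u c, role c)) u).card *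
        (chartBlock cB (fun u c => (sym u c, role c)) u).card *
        (chartBlock cC (fun u c => (sym u c, role c)) u).card : ℕ) : ℝ) ^ ((2 + ε) / 3) →
      (p : ℝ) ^ 2 < (n : ℝ) ^ 2 * ((a * b : ℕ) : ℝ) ^ (1 + ε) := by
  intro p n a b k L A B cA cB cC role sym ε hp hS ha hb hcard hA0 hA1 hA2 hB0 hB1 hB2 hC0 hC1 hC2 hU
    hbeat
  exact chartCapacity_designs_need_density hp hS ha hb hcard hA0 hA1 hA2 hB0 hB1 hB2 hC0 hC1 hC2 role
    sym hU hbeat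

/-- **Registered form (crux stmt-MatrixMultiplication-10647, stub `chartCapacity_needDensity_mixed`)** of
`chartCapacity_designs_need_density_mixed`: the same for arbitrary rows over the rotated chart, with the
constant `27`: blocks beating `2 + ε` force `p² < 27 n² (ab)^{1+ε}`. [folklore] -/
theorem chartCapacity_needDensity_mixed :
    ∀ (p n a b k L : ℕ) (A B : Fin n → Finset (ZMod p)) (cA cB cC : Fin n × Fin 3 → Finset (ZMod p))
      (row : Fin L → Fin k → Fin n × Fin 3) (ε : ℝ), p.Prime → IsSDPP A B → 1 ≤ a → 1 ≤ b →
      (∀ i, (A i).card = a ∧ (B i).card = b) →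
      (∀ i, cA (i, 0) = A i) → (∀ i, cA (i, 1) = {0}) → (∀ i, cA (i, 2) = B i) →
      (∀ i, cB (i, 0) = B i) → (∀ i, cB (i, 1) = A i) → (∀ i, cB (i, 2) = {0}) →
      (∀ i, cC (i, 0) = {0}) → (∀ i, cC (i, 1) = B i) → (∀ i, cC (i, 2) = A i) →
      IsLocalChartUSP cA cB cC row →
      (p : ℝ) ^ k < ∑ u : Fin L, (((chartBlock cA row u).card * (chartBlock cB row u).card *
        (chartBlock cC row u).card : ℕ) : ℝ) ^ ((2 + ε) / 3) →
      (p : ℝ) ^ 2 < 27 * (n : ℝ) ^ 2 * ((a * b : ℕ) : ℝ) ^ (1 + ε) := by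
  intro p n a b k L A B cA cB cC row ε hp hS ha hb hcard hA0 hA1 hA2 hB0 hB1 hB2 hC0 hC1 hC2 hU hbeat
  exact chartCapacity_designs_need_density_mixed hp hS ha hb hcard hA0 hA1 hA2 hB0 hB1 hB2 hC0 hC1
    hC2 row hU hbeat

end Registered

end Summit.MatrixMultiplication.MatrixMultiplication.Theorems.HomocyclicSTPPDesigns.ClusteredCharts
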